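import Summits.CriticalPhenomena.CardyFormulaZ2.Theorems.CardyFlipRussoVoronoiHubFromSmirnovStubMeasurableCrossEventContinuum
import Mathlib.Analysis.InnerProductSpace.Basic
import HarnessLib

/-!
# S0 reduced to plane topology: the black region near `closure Ω` is a finite union of closed convex cells (stub `stub_measurableCrossEvent`, part 4)

Helper file `--supports stmt-CriticalPhenomena-6433` (line `moebius-exact-delaunay-dilation-ward`,
stub S0 `stub_measurableCrossEvent` of the crux `VoronoiHubFromSmirnov`).  For a pair
`c = (black nuclei, white nuclei)` of locally finite configurations and a mesh `δ > 0`, the closed black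
region `B_δ(c) = {z | infDist (z/δ) c.1 ≤ infDist (z/δ) c.2}` meets the compact set `closure Ω` in
`closure Ω ∩ ⋃_{p ∈ I} cell p`, where `I ⊆ c.1` is FINITE and
`cell p = {z | dist (z/δ) p ≤ infDist (z/δ) c.2}` (the Voronoi cell of the black nucleus `p` against the
white nuclei, at scale `δ`) is closed, convex, with `δ p` in its interior (`convex_cell`, `isClosed_cell`,
`interior_cell_nonempty`, `exists_convexPieces`).  Consequently (`stub_measurableCrossEvent_of_joinedIn_convexPieces`)
the stub S0 — measurability of the crux's PATH crossing event — follows, via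
`measurableSet_crossEvent_of_joined`, from the following statement of plane topology, which is the
exact remaining obligation:

> for every Jordan domain `Ω` and every finite family `𝒞` of closed convex subsets of `ℂ` with
> nonempty interiors, any two points of a connected subset of `closure Ω ∩ ⋃₀ 𝒞` are joined by a path
> in `closure Ω ∩ ⋃₀ 𝒞` (the components of a closed Jordan domain cut by finitely many convex bodies
> are path connected).

The two junk cases are settled here: `c.1 = ∅` (every point is black, `𝒞 = {univ}`) and `c.2 = ∅`,
`c.1 ≠ ∅` (the black points of `closure Ω` form a finite set, on which connected sets are points).
-/

noncomputable section

namespace Summit.CriticalPhenomena.CardyFormulaZ2.Cruxes.VoronoiHubFromSmirnov.MoebiusExactDelaunayDilationWard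

open scoped Topology
open Set MeasureTheory Metric Filter
open Literature.Analysis.FunctionSpaces
open Literature.Probability.RandomPlanarGeometry

/-! ### Locally finite configurations -/

/-- A locally finite configuration is a closed subset of the plane. -/
theorem isClosed_coe_pointConfig (c : PointConfig ℂ) : IsClosed (c : Set ℂ) := by
  rw [← isOpen_compl_iff, Metric.isOpen_iff]
  intro z hz
  have hF : IsClosed (c.carrier ∩ closedBall z 1) :=
    (c.finite_inter_isCompact _ (isCompact_closedBall z 1)).isClosed
  have hzF : z ∈ (c.carrier ∩ closedBall z 1)ᶜ := fun h => hz h.1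
  obtain ⟨r, hr, hrF⟩ := Metric.isOpen_iff.1 hF.isOpen_compl z hzF
  refine ⟨min r 1, lt_min hr one_pos, fun w hw hwc => hrF (ball_subset_ball (min_le_left _ _) hw) ⟨hwc, ?_⟩⟩
  exact mem_closedBall.2 ((mem_ball.1 hw).le.trans (min_le_right _ _))

/-- Points of a locally finite configuration are isolated, quantitatively: around every point `p` of the
plane there is a radius `r > 0` within which the configuration has no point other than (possibly) `p`. -/
theorem exists_pos_forall_le_dist_pointConfig (c : PointConfig ℂ) (p : ℂ) :
    ∃ r > 0, ∀ q ∈ (c : Set ℂ), q ≠ p → r ≤ dist p q := by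
  have hD : IsClosed ((c.carrier ∩ closedBall p 1) \ {p}) :=
    ((c.finite_inter_isCompact _ (isCompact_closedBall p 1)).sdiff).isClosed
  have hpD : p ∈ ((c.carrier ∩ closedBall p 1) \ {p})ᶜ := fun h => h.2 rfl
  obtain ⟨ρ, hρ, hρD⟩ := Metric.isOpen_iff.1 hD.isOpen_compl p hpD
  refine ⟨min ρ 1, lt_min hρ one_pos, fun q hq hqp => ?_⟩
  by_contra hlt
  push Not at hlt
  refine hρD (mem_ball'.2 (hlt.trans_le (min_le_left _ _))) ⟨⟨hq, ?_⟩, hqp⟩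
  exact mem_closedBall'.2 (hlt.le.trans (min_le_right _ _))

/-! ### Bisector half-planes and Voronoi cells are convex -/

/-- The closed half-plane of points at least as close to `p` as to `q` is convex (it is
`{w | ⟪q - p, w⟫ ≤ (‖q‖² - ‖p‖²)/2}`). -/
theorem convex_setOf_dist_le_dist (p q : ℂ) : Convex ℝ {w : ℂ | dist w p ≤ dist w q} := by
  have hset : {w : ℂ | dist w p ≤ dist w q} = {w | inner ℝ (q - p) w ≤ (‖q‖ ^ 2 - ‖p‖ ^ 2) / 2} := by
    ext w
    simp only [mem_setOf_eq]
    rw [← sq_le_sq₀ dist_nonneg dist_nonneg, dist_eq_norm, dist_eq_norm, norm_sub_sq_real,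
      norm_sub_sq_real, inner_sub_left, real_inner_comm q w, real_inner_comm p w]
    constructor <;> intro h <;> linarith
  rw [hset]
  exact convex_halfSpace_le ⟨fun x y => inner_add_right _ _ _,
    fun a x => by rw [real_inner_smul_right, smul_eq_mul]⟩ _

/-- Rescaling `z ↦ z/δ` is real-linear. -/
theorem isLinearMap_div_ofReal (δ : ℝ) : IsLinearMap ℝ fun z : ℂ => z / (δ : ℂ) :=
  ⟨fun x y => add_div x y _, fun a x => smul_div_assoc a x _⟩

/-- **Voronoi cells against a set are convex**: for every `p` and every set `W` of (white) nuclei, the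
cell `{z | dist (z/δ) p ≤ infDist (z/δ) W}` at scale `δ` is convex (an intersection of bisector
half-planes; for `W = ∅` it is the point `δ p`). -/
theorem convex_cell (δ : ℝ) (p : ℂ) (W : Set ℂ) :
    Convex ℝ {z : ℂ | dist (z / (δ : ℂ)) p ≤ infDist (z / (δ : ℂ)) W} := by
  rcases W.eq_empty_or_nonempty with rfl | hW
  · have hset : {z : ℂ | dist (z / (δ : ℂ)) p ≤ infDist (z / (δ : ℂ)) (∅ : Set ℂ)} =
        (fun z : ℂ => z / (δ : ℂ)) ⁻¹' closedBall p 0 := by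
      ext z
      simp only [infDist_empty, mem_setOf_eq, mem_preimage, mem_closedBall]
    rw [hset]
    exact (convex_closedBall p 0).is_linear_preimage (isLinearMap_div_ofReal δ)
  · have hset : {z : ℂ | dist (z / (δ : ℂ)) p ≤ infDist (z / (δ : ℂ)) W} =
        ⋂ q ∈ W, (fun z : ℂ => z / (δ : ℂ)) ⁻¹' {w | dist w p ≤ dist w q} := by
      ext z
      simp only [mem_setOf_eq, mem_iInter, mem_preimage]
      haveI : Nonempty W := hW.to_subtype
      rw [infDist_eq_iInf, le_ciInf_iff ⟨0, ?_⟩]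
      · exact ⟨fun h q hq => h ⟨q, hq⟩, fun h q => h q q.2⟩
      · rintro _ ⟨q, rfl⟩
        exact dist_nonneg
    rw [hset]
    exact convex_iInter₂ fun q _ => (convex_setOf_dist_le_dist p q).is_linear_preimage
      (isLinearMap_div_ofReal δ)

/-- Voronoi cells against a set are closed. -/
theorem isClosed_cell (δ : ℝ) (p : ℂ) (W : Set ℂ) :
    IsClosed {z : ℂ | dist (z / (δ : ℂ)) p ≤ infDist (z / (δ : ℂ)) W} :=
  isClosed_le ((continuous_id.div_const _).dist continuous_const)
    ((continuous_infDist_pt W).comp (continuous_id.div_const _))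

/-- A point closer to `p` than half the gap of `W` around `p` is at least as close to `p` as to `W`. -/
theorem dist_le_infDist_of_gap {W : Set ℂ} (hW : W.Nonempty) {p : ℂ} {r : ℝ}
    (hr : ∀ q ∈ W, q ≠ p → r ≤ dist p q) {w : ℂ} (hw : dist w p < r / 2) :
    dist w p ≤ infDist w W := by
  haveI : Nonempty W := hW.to_subtype
  rw [infDist_eq_iInf]
  refine le_ciInf fun q => ?_
  by_cases hqp : (q : ℂ) = p
  · rw [hqp]
  · have h1 := hr q q.2 hqp
    have h2 := dist_triangle p w q
    rw [dist_comm p w] at h2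
    linarith

/-- **Voronoi cells of a locally finite configuration have nonempty interior**: for a nonempty locally
finite configuration `W` of white nuclei, `δ > 0` and any `p`, the cell
`{z | dist (z/δ) p ≤ infDist (z/δ) W}` contains a ball about `δ p`. -/
theorem interior_cell_nonempty {δ : ℝ} (hδ : 0 < δ) (p : ℂ) (W : PointConfig ℂ) (hW : (W : Set ℂ).Nonempty) :
    (interior {z : ℂ | dist (z / (δ : ℂ)) p ≤ infDist (z / (δ : ℂ)) (W : Set ℂ)}).Nonempty := by
  obtain ⟨r, hr, hrW⟩ := exists_pos_forall_le_dist_pointConfig W p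
  refine ⟨(δ : ℂ) * p, mem_interior.2 ⟨ball ((δ : ℂ) * p) (δ * (r / 2)), fun z hz => ?_, isOpen_ball,
    mem_ball_self (by positivity)⟩⟩
  have hδ' : (δ : ℂ) ≠ 0 := Complex.ofReal_ne_zero.2 hδ.ne'
  have hzp : dist (z / (δ : ℂ)) p < r / 2 := by
    have h1 : z / (δ : ℂ) - p = (z - (δ : ℂ) * p) / (δ : ℂ) := by
      field_simp
    rw [dist_eq_norm, h1, norm_div, Complex.norm_real, Real.norm_eq_abs, abs_of_pos hδ,
      div_lt_iff₀ hδ, ← dist_eq_norm]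
    calc dist z ((δ : ℂ) * p) < δ * (r / 2) := mem_ball.1 hz
      _ = r / 2 * δ := by ring
  exact dist_le_infDist_of_gap hW hrW hzp

/-! ### The black region near `closure Ω` -/

/-- **Finite convex structure of the black region on a compact set.** For `δ > 0` and nonempty
configurations of black and white nuclei, there is a FINITE family `𝒞` of closed convex sets with
nonempty interiors (the cells of finitely many black nuclei against the white nuclei) such that the
closed black region `{z | infDist (z/δ) c.1 ≤ infDist (z/δ) c.2}` and `⋃₀ 𝒞` have the same trace on
`closure Ω`. -/
theorem exists_convexPieces (Ω : JordanDomain) {δ : ℝ} (hδ : 0 < δ) (c : PointConfig ℂ × PointConfig ℂ)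
    (h1 : (c.1 : Set ℂ).Nonempty) (h2 : (c.2 : Set ℂ).Nonempty) :
    ∃ 𝒞 : Set (Set ℂ), 𝒞.Finite ∧ (∀ C ∈ 𝒞, IsClosed C ∧ Convex ℝ C ∧ (interior C).Nonempty) ∧
      closure Ω.carrier ∩ {z | infDist (z / (δ : ℂ)) (c.1 : Set ℂ) ≤ infDist (z / (δ : ℂ)) (c.2 : Set ℂ)} =
        closure Ω.carrier ∩ ⋃₀ 𝒞 := by
  -- bounds on the compact set `closure Ω`
  have hcpt : IsCompact (closure Ω.carrier) := Ω.isBounded.isCompact_closure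
  obtain ⟨M₁, hM₁⟩ := hcpt.exists_bound_of_continuousOn (f := fun z : ℂ => z / (δ : ℂ))
    (continuous_id.div_const _).continuousOn
  obtain ⟨M₂, hM₂⟩ := hcpt.exists_bound_of_continuousOn
    (f := fun z : ℂ => infDist (z / (δ : ℂ)) (c.2 : Set ℂ))
    ((continuous_infDist_pt _).comp (continuous_id.div_const _)).continuousOn
  -- the finitely many relevant black nuclei
  set I : Set ℂ := {p | p ∈ (c.1 : Set ℂ) ∧ (closure Ω.carrier ∩
    {z | dist (z / (δ : ℂ)) p ≤ infDist (z / (δ : ℂ)) (c.2 : Set ℂ)}).Nonempty} with hI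
  have hIfin : I.Finite := by
    refine (c.1.finite_inter_isCompact _ (isCompact_closedBall (0 : ℂ) (M₁ + M₂))).subset ?_
    rintro p ⟨hp, z, hzΩ, hz⟩
    refine ⟨hp, mem_closedBall_zero_iff.2 ?_⟩
    rw [mem_setOf_eq] at hz
    have hb1 := hM₁ z hzΩ
    have hb2 := hM₂ z hzΩ
    rw [Real.norm_eq_abs, abs_of_nonneg infDist_nonneg] at hb2
    calc ‖p‖ ≤ ‖z / (δ : ℂ)‖ + dist (z / (δ : ℂ)) p := by
          have := norm_le_norm_add_norm_sub' p (z / (δ : ℂ))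
          rwa [← dist_eq_norm, dist_comm] at this
      _ ≤ M₁ + M₂ := add_le_add hb1 (hz.trans hb2)
  refine ⟨(fun p => {z | dist (z / (δ : ℂ)) p ≤ infDist (z / (δ : ℂ)) (c.2 : Set ℂ)}) '' I,
    hIfin.image _, ?_, ?_⟩
  · rintro _ ⟨p, -, rfl⟩
    exact ⟨isClosed_cell δ p _, convex_cell δ p _, interior_cell_nonempty hδ p c.2 h2⟩
  · ext z
    simp only [mem_inter_iff, mem_setOf_eq, sUnion_image, mem_iUnion, exists_prop]
    constructor
    · rintro ⟨hzΩ, hz⟩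
      obtain ⟨p, hp, hpd⟩ := (isClosed_coe_pointConfig c.1).exists_infDist_eq_dist h1 (z / (δ : ℂ))
      have hzp : dist (z / (δ : ℂ)) p ≤ infDist (z / (δ : ℂ)) (c.2 : Set ℂ) := hpd ▸ hz
      exact ⟨hzΩ, p, ⟨hp, z, hzΩ, hzp⟩, hzp⟩
    · rintro ⟨hzΩ, p, ⟨hp, -⟩, hzp⟩
      exact ⟨hzΩ, (infDist_le_dist_of_mem hp).trans hzp⟩

/-- In the junk case `c.2 = ∅`, `c.1 ≠ ∅` the black points of `closure Ω` form a finite set (the scaled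
black nuclei in `closure Ω`). -/
theorem finite_black_of_snd_empty (Ω : JordanDomain) {δ : ℝ} (hδ : 0 < δ) (c : PointConfig ℂ × PointConfig ℂ)
    (h1 : (c.1 : Set ℂ).Nonempty) (h2 : (c.2 : Set ℂ) = ∅) :
    (closure Ω.carrier ∩ {z | infDist (z / (δ : ℂ)) (c.1 : Set ℂ) ≤
      infDist (z / (δ : ℂ)) (c.2 : Set ℂ)}).Finite := by
  have hδ' : (δ : ℂ) ≠ 0 := Complex.ofReal_ne_zero.2 hδ.ne'
  have hcpt : IsCompact ((fun z : ℂ => z / (δ : ℂ)) '' closure Ω.carrier) :=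
    Ω.isBounded.isCompact_closure.image (continuous_id.div_const _)
  have hfin : ((fun z : ℂ => z / (δ : ℂ)) ⁻¹' ((c.1 : Set ℂ) ∩
      (fun z : ℂ => z / (δ : ℂ)) '' closure Ω.carrier)).Finite :=
    (c.1.finite_inter_isCompact _ hcpt).preimage fun x _ y _ hxy => (div_left_inj' hδ').1 hxy
  refine hfin.subset ?_
  rintro z ⟨hzΩ, hz⟩
  rw [mem_setOf_eq, h2, infDist_empty] at hz
  have h0 : infDist (z / (δ : ℂ)) (c.1 : Set ℂ) = 0 := le_antisymm hz infDist_nonneg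
  have hmem : z / (δ : ℂ) ∈ (c.1 : Set ℂ) := by
    rw [(isClosed_coe_pointConfig c.1).mem_iff_infDist_zero h1]
    exact h0
  exact ⟨hmem, z, hzΩ, rfl⟩

/-- A preconnected subset of a finite set of the plane has at most one point. -/
theorem subsingleton_of_isPreconnected_of_finite {S F : Set ℂ} (hF : F.Finite) (hSF : S ⊆ F)
    (hS : IsPreconnected S) : S.Subsingleton := by
  intro x hx y hy
  by_contra hne
  have hfinS : S.Finite := hF.subset hSF
  have h := (isPreconnected_closed_iff.1 hS) {x} (S \ {x}) isClosed_singleton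
    (hfinS.sdiff).isClosed (fun z hz => (em (z = x)).elim Or.inl fun h => Or.inr ⟨hz, h⟩)
    ⟨x, hx, rfl⟩ ⟨y, hy, hy, fun h => hne (h ▸ rfl)⟩
  obtain ⟨z, -, hzx, -, hzx'⟩ := h
  exact hzx' hzx

/-! ### The reduction -/

/-- **S0 follows from plane topology.** If, for every Jordan domain `Ω` and every finite family `𝒞`
of closed convex subsets of `ℂ` with nonempty interiors, any two points of a connected subset of
`closure Ω ∩ ⋃₀ 𝒞` are joined by a path inside `closure Ω ∩ ⋃₀ 𝒞` (path-connectedness of the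
components of a closed Jordan domain cut by finitely many convex bodies), then the crux's crossing
event `crossEvent R δ` is measurable for every conformal rectangle `R` and every mesh `δ > 0`
(`measurableSet_crossEvent_of_joined` + `exists_convexPieces`; the junk cases `c.1 = ∅`, `c.2 = ∅`
are settled directly). -/
theorem stub_measurableCrossEvent_of_joinedIn_convexPieces : (∀ (Ω : JordanDomain) (𝒞 : Set (Set ℂ)), 𝒞.Finite → (∀ C ∈ 𝒞, IsClosed C ∧ Convex ℝ C ∧ (interior C).Nonempty) → ∀ S ⊆ closure Ω.carrier ∩ ⋃₀ 𝒞, IsPreconnected S → ∀ x ∈ S, ∀ y ∈ S, JoinedIn (closure Ω.carrier ∩ ⋃₀ 𝒞) x y) → Sig.stub_measurableCrossEvent := by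
  intro htop
  show ∀ (R : ConformalRectangle) (δ : ℝ), 0 < δ → MeasurableSet (crossEvent R δ)
  intro R δ hδ
  refine measurableSet_crossEvent_of_joined R δ fun c S hS hSc hSA hSA' => ?_
  obtain ⟨x, hxS, hxA⟩ := hSA
  obtain ⟨y, hyS, hyA'⟩ := hSA'
  simp only [crossEvent, mem_setOf_eq]
  refine ⟨x, hxA, y, hyA', ?_⟩
  rcases (c.1 : Set ℂ).eq_empty_or_nonempty with h1 | h1
  · -- every point is black
    have hB : {z : ℂ | infDist (z / (δ : ℂ)) (c.1 : Set ℂ) ≤ infDist (z / (δ : ℂ)) (c.2 : Set ℂ)} = univ := by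
      refine eq_univ_of_forall fun z => ?_
      rw [mem_setOf_eq, h1, infDist_empty]
      exact infDist_nonneg
    have h𝒞 : ∀ C ∈ ({univ} : Set (Set ℂ)), IsClosed C ∧ Convex ℝ C ∧ (interior C).Nonempty := by
      intro C hC
      rw [mem_singleton_iff.1 hC, interior_univ]
      exact ⟨isClosed_univ, convex_univ, univ_nonempty⟩
    have key := htop R.toJordanDomain {univ} (finite_singleton _) h𝒞 S
      (by rw [sUnion_singleton, ← hB]; exact hS) hSc x hxS y hyS
    rwa [sUnion_singleton, ← hB] at key
  rcases (c.2 : Set ℂ).eq_empty_or_nonempty with h2 | h2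
  · -- finitely many black points: `S` is a point
    have hxy : x = y := subsingleton_of_isPreconnected_of_finite
      (finite_black_of_snd_empty R.toJordanDomain hδ c h1 h2) hS hSc hxS hyS
    subst hxy
    exact JoinedIn.refl (hS hxS)
  · obtain ⟨𝒞, h𝒞f, h𝒞, hK⟩ := exists_convexPieces R.toJordanDomain hδ c h1 h2
    have hS' : S ⊆ closure R.carrier ∩ ⋃₀ 𝒞 := hK ▸ hS
    have key := htop R.toJordanDomain 𝒞 h𝒞f h𝒞 S hS' hSc x hxS y hyS
    rwa [← hK] at key

end Summit.CriticalPhenomena.CardyFormulaZ2.Cruxes.VoronoiHubFromSmirnov.MoebiusExactDelaunayDilationWard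

end
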